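import Summits.QuantumFields.BalabanUV.T4Continuum.Support.ChainEndExact
import Summits.QuantumFields.BalabanUV.T4Continuum.Support.MinimalActionRefine
import HarnessLib

/-!
# T⁴ programme, node NE3 — the kinematic refinement lemma: `SmoothRefine` FROM AN APPROXIMATE COVARIANT REFINEMENT
# (glue R0, second half: the scale bookkeeping), and NE3's ACTION HALF from leaf R1 alone

NE3 prover lineage P1, gen 17 (cell `pub-balaban`, unit `b2b-balaban-t4-ne3-p1`, row NE3 OWNER); skeleton SKELETON-NE3-P1.md
v1.1 §3 leaves R0∕R1∕R2.  With leaf R2 (exactness of the block-average constraint by the chain-end fix,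
`ChainEndExact.exists_exact_refinement`) in hand, the kinematic shape `MinimalActionRefine.SmoothRefine` on the
small-field class reduces to the APPROXIMATE shape **`ApproxRefine`** (§1, leaf R1, OURS, OPEN): every sup-form regular
level-`j` configuration of the class admits a `U(N)`-valued `(N·L^{j+1})`-periodic fine configuration with plaquettes
`≤ b₁(L^{j+1})^{−2}`, covariant flux gradients `≤ c₁(L^{j+1})^{−3}`, and block-average MISMATCH `≤ m(L^j)^{−3}` — no
exactness asked.  **`smoothRefine_of_approxRefine`** (§2): `ApproxRefine … b c b₁ c₁ m` ⇒
`SmoothRefine … b c (b₁ + 8mL³/g) (c₁ + 36mL³/g)`, `g = gap d L = L^{1−d}`, under the explicit smallness conditions of the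
chain-end fix (`512(d+1)(d+4)L²b₁ ≤ 1`, `4(16(d+1)(d+4)L²b₁ + 2m/g) ≤ g`, `b₁ + 8m/g ≤ 1/2`, `b₁ + 8mL³/g ≤ ε`).
**`actionRate_sfClass_of_approxRefine`** (§3): NE3's ACTION half `T4EtaRateMin.ActionRate … (L⁻²)` for the small-field
class from (H1) existence + (H3ˢᵘᵖ) sup-form regularity of the minimisers + (H0) the datum's level-0 regularity (all B11
Thm 1 TYPE, hypotheses) + `ApproxRefine` (leaf R1) — the whole refinement side of the sandwich is now ONE elementary,
manuscript-free, exactness-free kinematic statement.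

HONEST FRAMING.  Bookkeeping over landed∕staged modules; no estimate of the cell, no conditional (`BetaPertH`, (B),
(B^μ)) used or hidden; nothing bears on infinite volume, a mass gap, or the Clay problem; **NE3 is NOT proved**:
`ApproxRefine` (leaf R1: covariant cell-by-cell filling with pre-compensated 1-skeleton) is a hypothesis SHAPE asserted for
no class here, and (H1)(H3ˢᵘᵖ)(H0) are B11 Thm 1 TYPE hypotheses.  ABSOLUTE RULE kept; no `sorry`, no axioms beyond
Mathlib's.  PLACEMENT: `Summits/QuantumFields/BalabanUV/`; imports this lineage's `ChainEndExact`, `MinimalActionRefine`.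
-/

set_option autoImplicit false

open scoped BigOperators Matrix Matrix.Norms.L2Operator
open NormedSpace

namespace Summit.QuantumFields.BalabanUV.T4Continuum.SmoothRefineOfApprox

open Literature.MathematicalPhysics.QuantumFieldTheory.Balaban1983to89
open B7Prop1Explicit B7Prop2Explicit MatrixLog UnitaryModel
open T4AveragingDeficitWall hiding Site Plane Plaq Bond
open T4AveragingDeficitWallBoundary (IsPeriodicCfg)
open T4AveragingDeficitNonAbelian (wallConstNA)
open T4EtaRateMin (Readings ActionRate)
open MinimalActionSandwich MinimalActionRate MinimalActionRefine ChainEndFix ChainEndExact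

noncomputable section

variable {d : ℕ} {n : Type*} [Fintype n] [DecidableEq n] [Nonempty n]

/-! ## §1 The approximate covariant refinement shape (leaf R1) -/

variable (d) in
/-- **THE APPROXIMATE COVARIANT REFINEMENT SHAPE** (leaf R1 of the kinematic lemma; OURS; a hypothesis SHAPE asserted for
no class here): within the class family `𝒞`, every level-`j` configuration with sup-form regularity data `(b, c)` admits a
`U(N)`-valued `(N·L^{j+1})`-periodic fine configuration `W` with plaquettes `≤ b₁(L^{j+1})^{−2}`, covariant flux gradients
`≤ c₁(L^{j+1})^{−3}`, and block-average mismatch `‖U(z,κ) − rescale L (bavg L W) (z,κ)‖ ≤ m(L^j)^{−3}` everywhere.  The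
intended proof (skeleton v1.1 §2 ¶3): covariant cell-by-cell filling of the refined lattice with the PRE-COMPENSATED
1-skeleton `T = exp(−X₀)U`; ancestry Lüscher 1982 ∕ 't Hooft 1995 ∕ Endres et al. 2015 (none states it). [folklore] -/
@[folklore]
def ApproxRefine (𝒞 : ℕ → Set (Site d → Fin d → (Matrix n n ℂ)ˣ)) (L N : ℕ) (b c b₁ c₁ m : ℝ) : Prop :=
  ∀ (j : ℕ) (U : Site d → Fin d → (Matrix n n ℂ)ˣ), U ∈ 𝒞 j → RegularSup d L N b c j U →
    ∃ W : Site d → Fin d → (Matrix n n ℂ)ˣ, IsUnitaryCfg W ∧ IsPeriodicCfg W ((N * L ^ (j + 1) : ℕ) : ℤ) ∧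
      SmallField W (b₁ / ((L : ℝ) ^ (j + 1)) ^ 2) ∧
      (∀ (x : Site d) (κ : Fin d) (π : T4AveragingDeficitWall.Plane d),
        ‖covGrad W (flux W) x κ π‖ ≤ c₁ / ((L : ℝ) ^ (j + 1)) ^ 3) ∧
      ∀ (z : Site d) (κ : Fin d), ‖((U z κ : (Matrix n n ℂ)ˣ) : (Matrix n n ℂ)) - ((rescale L (bavg L W) z κ : (Matrix n n ℂ)ˣ) : (Matrix n n ℂ))‖ ≤ m / ((L : ℝ) ^ j) ^ 3

/-! ## §2 `SmoothRefine` from `ApproxRefine` via the chain-end fix -/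

/-- Scale bookkeeping: `8·(m/(L^j)³)/g ≤ (8mL³/g)/(L^{j+1})²` and `36·(m/(L^j)³)/g = (36mL³/g)/(L^{j+1})³` (`L ≥ 1`).
[folklore] -/
theorem scale_bookkeeping {L : ℕ} (hL : 1 ≤ L) {m g : ℝ} (hm : 0 ≤ m) (hg : 0 < g) (j : ℕ) :
    8 * (m / ((L : ℝ) ^ j) ^ 3) / g ≤ 8 * m * (L : ℝ) ^ 3 / g / ((L : ℝ) ^ (j + 1)) ^ 2 ∧
    36 * (m / ((L : ℝ) ^ j) ^ 3) / g = 36 * m * (L : ℝ) ^ 3 / g / ((L : ℝ) ^ (j + 1)) ^ 3 := by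
  have hL1 : (1 : ℝ) ≤ L := by exact_mod_cast hL
  have hL0 : (0 : ℝ) < L := by linarith
  set t : ℝ := (L : ℝ) ^ j with htdef
  have ht1 : 1 ≤ t := one_le_pow₀ hL1
  have ht0 : 0 < t := by linarith
  have hgne : g ≠ 0 := hg.ne'
  have htne : t ≠ 0 := ht0.ne'
  have hLne : (L : ℝ) ≠ 0 := hL0.ne'
  have hs : (L : ℝ) ^ (j + 1) = t * L := by rw [htdef, pow_succ]
  rw [hs]
  refine ⟨?_, ?_⟩
  · have h1 : 8 * (m / t ^ 3) / g = 8 * m / g * (1 / t ^ 3) := by field_simp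
    have h2 : 8 * m * (L : ℝ) ^ 3 / g / (t * L) ^ 2 = 8 * m / g * (L / t ^ 2) := by field_simp
    have h3 : 1 / t ^ 3 ≤ (L : ℝ) / t ^ 2 := by
      rw [div_le_div_iff₀ (by positivity) (by positivity)]
      have : t ^ 2 * 1 ≤ t ^ 2 * (L * t) := by
        refine mul_le_mul_of_nonneg_left ?_ (by positivity)
        nlinarith
      nlinarith
    rw [h1, h2]
    exact mul_le_mul_of_nonneg_left h3 (by positivity)
  · field_simp

/-- **`SmoothRefine` FROM `ApproxRefine`** on the small-field class: the exactness of the block-average constraint is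
supplied by the chain-end fix (`ChainEndExact.exists_exact_refinement`), at the cost `8mL³/g` on the plaquette radius
and `36mL³/g` on the flux-gradient constant (`g = gap d L`). [folklore] -/
theorem smoothRefine_of_approxRefine {L N : ℕ} (hL : 1 ≤ L) {b c b₁ c₁ m ε : ℝ} (hb₁ : 0 ≤ b₁) (hm : 0 ≤ m)
    (hbs : 512 * (d + 1) * (d + 4) * (L : ℝ) ^ 2 * b₁ ≤ 1)
    (hgap : 4 * (2 * (8 * (d + 1) * (d + 4) * (L : ℝ) ^ 2 * b₁) + 2 * m / gap d L) ≤ gap d L)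
    (hhalf : b₁ + 8 * m / gap d L ≤ 1 / 2) (hε : b₁ + 8 * m * (L : ℝ) ^ 3 / gap d L ≤ ε)
    (hA : ApproxRefine d (sfClass (n := n) d L N ε) L N b c b₁ c₁ m) :
    SmoothRefine d (sfClass (n := n) d L N ε) L N b c (b₁ + 8 * m * (L : ℝ) ^ 3 / gap d L)
      (c₁ + 36 * m * (L : ℝ) ^ 3 / gap d L) := by
  intro j U hU hreg
  obtain ⟨W, hWu, hWp, hWs, hWg, hWm⟩ := hA j U hU hreg
  have hL1 : (1 : ℝ) ≤ L := by exact_mod_cast hL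
  have hg := (gap_pos (d := d) hL).1
  have hg1 := (gap_pos (d := d) hL).2
  set s : ℝ := ((L : ℝ) ^ (j + 1)) with hsdef
  have hs1 : 1 ≤ s := one_le_pow₀ hL1
  have ht1 : (1 : ℝ) ≤ ((L : ℝ) ^ j) ^ 3 := one_le_pow₀ (one_le_pow₀ hL1)
  -- the level-`j` constants are below the level-free ones
  set a : ℝ := b₁ / s ^ 2 with hadef
  set δ : ℝ := m / ((L : ℝ) ^ j) ^ 3 with hδdef
  have ha0 : 0 ≤ a := div_nonneg hb₁ (by positivity)
  have hδ0 : 0 ≤ δ := div_nonneg hm (by positivity)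
  have hab : a ≤ b₁ := div_le_self hb₁ (one_le_pow₀ hs1)
  have hδm : δ ≤ m := div_le_self hm ht1
  have hsmall : 512 * (d + 1) * (d + 4) * (L : ℝ) ^ 2 * a ≤ 1 := by
    have h0 : (0 : ℝ) ≤ 512 * (d + 1) * (d + 4) * (L : ℝ) ^ 2 := by positivity
    nlinarith
  have hgap' : 4 * (2 * (8 * (d + 1) * (d + 4) * (L : ℝ) ^ 2 * a) + 2 * δ / gap d L) ≤ gap d L := by
    have h0 : (0 : ℝ) ≤ 8 * (d + 1) * (d + 4) * (L : ℝ) ^ 2 := by positivity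
    have h1 : 2 * δ / gap d L ≤ 2 * m / gap d L := div_le_div_of_nonneg_right (by linarith) hg.le
    nlinarith
  have hhalf' : a + 8 * δ / gap d L ≤ 1 / 2 := by
    have h1 : 8 * δ / gap d L ≤ 8 * m / gap d L := div_le_div_of_nonneg_right (by linarith) hg.le
    linarith
  -- periods: `W` is `L·(N L^j)`-periodic, `U` is `(N L^j)`-periodic and unitary (class membership)
  have hNL : N * L ^ (j + 1) = L * (N * L ^ j) := by ring
  have hWp' : IsPeriodicCfg W ((L * (N * L ^ j) : ℕ) : ℤ) := by rw [← hNL]; exact hWp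
  obtain ⟨W', hW'u, hW'p, hW'avg, hW's, hW'g⟩ := exists_exact_refinement hL hWu hU.1 ha0 hδ0 hsmall hWs hWg hWm
    hgap' hhalf' hWp' hU.2.1
  have hbook := scale_bookkeeping hL hm hg j
  have hW'p2 : IsPeriodicCfg W' ((N * L ^ (j + 1) : ℕ) : ℤ) := by rw [hNL]; exact hW'p
  have hsmall' : SmallField W' ((b₁ + 8 * m * (L : ℝ) ^ 3 / gap d L) / ((L : ℝ) ^ (j + 1)) ^ 2) := by
    refine SmallField.mono hW's ?_
    rw [add_div]
    exact add_le_add le_rfl hbook.1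
  refine ⟨W', ⟨hW'u, hW'p2, ?_⟩, hW'avg, ⟨hW'u, hW'p2, hsmall', fun x κ π => (hW'g x κ π).trans (le_of_eq ?_)⟩⟩
  · exact SmallField.mono hsmall' (div_le_div_of_nonneg_right hε (by positivity))
  · rw [add_div, hbook.2]

/-! ## §3 NE3's action half from leaf R1 alone -/

/-- **NE3, ACTION HALF, FOR THE SMALL-FIELD CLASS, FROM THE APPROXIMATE REFINEMENT** — `T4EtaRateMin.ActionRate` BY NAME
with rate `θ = L^{−2}`: (H1) minimisers exist, (H3ˢᵘᵖ) they have sup-form regularity `(b, c)`, (H0) the data of `dom` have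
sup-form regularity `(b, c)` at level `0` (all B11 Thm 1 TYPE hypothesis shapes), and the approximate covariant refinement
`ApproxRefine … b c b₁ c₁ m` (leaf R1, ours) — exactness of the refinement being FREE (leaf R2, kernel).  Explicit constant
`wallConstNA(d,L)·(gradConst d (max c c′) + (max b b′)³)/L²` with `b′ = b₁ + 8mL³/g`, `c′ = c₁ + 36mL³/g`.
NE3 is NOT proved: every input is a hypothesis SHAPE. [folklore] -/
theorem actionRate_sfClass_of_approxRefine {L N : ℕ} (hL : 1 ≤ L) (hN : 1 ≤ N) {b c b₁ c₁ m ε : ℝ}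
    (hb : 0 ≤ b) (hb₁ : 0 ≤ b₁) (hm : 0 ≤ m)
    (hBs : 512 * (d + 1) * (d + 4) * (L : ℝ) ^ 2 * max b (b₁ + 8 * m * (L : ℝ) ^ 3 / gap d L) ≤ 1)
    (hbε : b + 226 * (8 * (d + 1) * (d + 4)) ^ 2 * b ^ 2 ≤ ε)
    (hbs₁ : 512 * (d + 1) * (d + 4) * (L : ℝ) ^ 2 * b₁ ≤ 1)
    (hgap : 4 * (2 * (8 * (d + 1) * (d + 4) * (L : ℝ) ^ 2 * b₁) + 2 * m / gap d L) ≤ gap d L)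
    (hhalf : b₁ + 8 * m / gap d L ≤ 1 / 2) (hε : b₁ + 8 * m * (L : ℝ) ^ 3 / gap d L ≤ ε)
    {dom : Set (Site d → Fin d → (Matrix n n ℂ)ˣ)}
    (h1 : ∀ V ∈ dom, ∀ k : ℕ, ∃ U, IsMinimiser d (sfClass d L N ε) L N k V U)
    (h3 : ∀ V ∈ dom, ∀ (k : ℕ) (U : Site d → Fin d → (Matrix n n ℂ)ˣ),
      IsMinimiser d (sfClass d L N ε) L N (k + 1) V U → RegularSup d L N b c (k + 1) U)
    (h0 : ∀ V ∈ dom, RegularSup d L N b c 0 V)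
    (hA : ApproxRefine d (sfClass (n := n) d L N ε) L N b c b₁ c₁ m)
    {X : Type*} (loc : ℕ → (Site d → Fin d → (Matrix n n ℂ)ˣ) → X → ℝ) :
    ActionRate (minActReadings d (sfClass d L N ε) L N dom loc)
      (wallConstNA d L * (gradConst d (max c (c₁ + 36 * m * (L : ℝ) ^ 3 / gap d L))
        + (max b (b₁ + 8 * m * (L : ℝ) ^ 3 / gap d L)) ^ 3) / (L : ℝ) ^ 2) (((L : ℝ) ^ 2)⁻¹) :=
  actionRate_sfClass_of_smoothRefine hL hN hb hBs hbε h1 h3 h0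
    (smoothRefine_of_approxRefine hL hb₁ hm hbs₁ hgap hhalf hε hA) loc

end

end Summit.QuantumFields.BalabanUV.T4Continuum.SmoothRefineOfApprox
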